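import Literature.MathematicalPhysics.KineticTheory.Hilbert6Wave0Proofs

/-!
# Collision-invariant characteristic functions, I: the modulus (helper for `ParityRigidity`)

Let `m` be a probability measure on a finite-dimensional real inner product space `E` of
dimension `≥ 2` whose characteristic function `φ = charFun m` satisfies the multiplicative
collision invariance `φ ξ * φ η = φ ξ' * φ η'` for every impact direction `ω`,
`(ξ', η') = collide ω (ξ, η)`.  This file proves: orthogonal multiplicativity of `φ` (`η = 0`),
radiality and non-vanishing of `‖φ‖`, and the Gaussian form of the modulus
`‖φ ξ‖ = exp (-θ‖ξ‖²)`, `θ ≥ 0` (`exists_norm_charFun_eq_exp`: `log ‖φ‖²` is a continuous even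
collision invariant vanishing at `0`, hence `c‖ξ‖²` by the tree's
`IsCollisionInvariant.exists_eq_quadratic_holds`).  It also records the elementary lemma that a
unimodular function, multiplicative on `[0, ∞)` with zero derivative at `0`, is `≡ 1`
(`eq_one_of_mul_of_hasDerivAt_zero`), used for the phase in the companion file
`JParityClosureParityRigidityPhase`.

Helper file for item stmt-AtomisticToContinuum-13084 (route JParityClosure, decl `ParityRigidity`).
-/

open MeasureTheory Metric Real Filter Topology Set Complex
open scoped InnerProductSpace ENNReal NNReal Topology ComplexConjugate

namespace Summit.AtomisticToContinuum.HydrodynamicLimit.Theorems.ParityRigidity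

open Literature.MathematicalPhysics.KineticTheory

variable {E : Type*} [NormedAddCommGroup E] [InnerProductSpace ℝ E] [FiniteDimensional ℝ E]
  [MeasurableSpace E] [BorelSpace E]

/-! ### Unimodular multiplicative functions with zero derivative are trivial -/

/-- For `‖z‖ ≤ 1`, `‖z ^ n - 1‖ ≤ n ‖z - 1‖`. -/
theorem norm_pow_sub_one_le {z : ℂ} (hz : ‖z‖ ≤ 1) (n : ℕ) : ‖z ^ n - 1‖ ≤ n * ‖z - 1‖ := by
  induction n with
  | zero => simp
  | succ n ih =>
    have h : z ^ (n + 1) - 1 = z * (z ^ n - 1) + (z - 1) := by ring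
    rw [h]
    calc ‖z * (z ^ n - 1) + (z - 1)‖ ≤ ‖z * (z ^ n - 1)‖ + ‖z - 1‖ := norm_add_le _ _
      _ ≤ 1 * (n * ‖z - 1‖) + ‖z - 1‖ := by
          rw [norm_mul]
          gcongr
      _ = (n + 1 : ℕ) * ‖z - 1‖ := by push_cast; ring

/-- A function `k : ℝ → ℂ` of modulus `≤ 1` on `[0, ∞)`, multiplicative on `[0, ∞)` and with
derivative `0` at `0`, where `k 0 = 1`, is identically `1` on `[0, ∞)`. -/
theorem eq_one_of_mul_of_hasDerivAt_zero {k : ℝ → ℂ} (hk1 : ∀ t, 0 ≤ t → ‖k t‖ ≤ 1)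
    (hmul : ∀ s t, 0 ≤ s → 0 ≤ t → k (s + t) = k s * k t) (hk0 : k 0 = 1)
    (hder : HasDerivAt k 0 0) {t : ℝ} (ht : 0 ≤ t) : k t = 1 := by
  rcases ht.eq_or_lt with rfl | ht
  · exact hk0
  -- `k (n s) = k s ^ n`
  have hpow : ∀ (n : ℕ) (s : ℝ), 0 ≤ s → k (n * s) = k s ^ n := by
    intro n s hs
    induction n with
    | zero => simp [hk0]
    | succ n ih =>
      rw [Nat.cast_succ, add_mul, one_mul, hmul _ _ (by positivity) hs, ih, pow_succ]
  -- slope at `0` tends to `0`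
  have hslope : Tendsto (fun s => s⁻¹ • (k (0 + s) - k 0)) (𝓝[≠] 0) (𝓝 0) :=
    hder.tendsto_slope_zero
  have hseq : Tendsto (fun n : ℕ => t / (n + 1 : ℝ)) atTop (𝓝[≠] 0) := by
    refine tendsto_nhdsWithin_iff.2 ⟨?_, Eventually.of_forall fun n => ?_⟩
    · have := tendsto_const_div_atTop_nhds_zero_nat t
      exact (tendsto_add_atTop_iff_nat 1).2 this |>.congr fun n => by push_cast; ring_nf
    · exact (div_pos ht (by positivity)).ne'
  have hlim : Tendsto (fun n : ℕ => t * ‖(t / (n + 1 : ℝ))⁻¹ • (k (0 + t / (n + 1 : ℝ)) - k 0)‖)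
      atTop (𝓝 0) := by
    have := (hslope.comp hseq).norm.const_mul t
    simpa using this
  -- `‖k t - 1‖ ≤ t * ‖slope‖`
  have hbound : ∀ n : ℕ, ‖k t - 1‖ ≤ t * ‖(t / (n + 1 : ℝ))⁻¹ • (k (0 + t / (n + 1 : ℝ)) - k 0)‖ := by
    intro n
    have hs : 0 ≤ t / (n + 1 : ℝ) := by positivity
    have hkt : k t = k (t / (n + 1 : ℝ)) ^ (n + 1) := by
      rw [← hpow (n + 1) _ hs]
      congr 1
      push_cast
      field_simp
    rw [hkt, zero_add, hk0, norm_smul, norm_inv, norm_div, Real.norm_eq_abs, Real.norm_eq_abs,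
      abs_of_pos ht, abs_of_pos (by positivity : (0 : ℝ) < n + 1)]
    calc ‖k (t / (n + 1 : ℝ)) ^ (n + 1) - 1‖ ≤ (n + 1 : ℕ) * ‖k (t / (n + 1 : ℝ)) - 1‖ :=
          norm_pow_sub_one_le (hk1 _ hs) _
      _ = t * ((t / (n + 1 : ℝ))⁻¹ * ‖k (t / (n + 1 : ℝ)) - 1‖) := by
          push_cast
          field_simp
  have h0 : ‖k t - 1‖ ≤ 0 :=
    ge_of_tendsto' hlim hbound
  exact sub_eq_zero.1 (norm_le_zero_iff.1 h0)


/-! ### Orthogonal multiplicativity of a collision-invariant characteristic function -/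

omit [FiniteDimensional ℝ E] [MeasurableSpace E] [BorelSpace E] in
/-- The collision with impact direction `b/‖b‖` maps the pair `(a + b, 0)` with `a ⊥ b` to
`(a, b)`. -/
theorem collide_add_zero_eq {a b : E} (hab : ⟪a, b⟫_ℝ = 0) (hb : b ≠ 0)
    (ω : sphere (0 : E) 1) (hω : (ω : E) = ‖b‖⁻¹ • b) :
    collide ω (a + b, 0) = (a, b) := by
  have hn : ‖b‖ ≠ 0 := norm_ne_zero_iff.mpr hb
  have hinner : ⟪a + b - 0, ‖b‖⁻¹ • b⟫_ℝ = ‖b‖ := by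
    rw [sub_zero, real_inner_smul_right, inner_add_left, hab, real_inner_self_eq_norm_sq, zero_add,
      sq, ← mul_assoc, inv_mul_cancel₀ hn, one_mul]
  have hs : ‖b‖ • (‖b‖⁻¹ • b) = b := by
    rw [smul_smul, mul_inv_cancel₀ hn, one_smul]
  simp only [collide, hω, hinner, hs, zero_add, Prod.mk.injEq]
  exact ⟨add_sub_cancel_right a b, trivial⟩

section Modulus

variable (m : Measure E) [IsProbabilityMeasure m]

omit [FiniteDimensional ℝ E] [BorelSpace E] in
/-- Orthogonal multiplicativity: `φ (a + b) = φ a * φ b` for `a ⊥ b`, from the collision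
invariance with `η = 0`. -/
theorem charFun_add_of_inner_eq_zero
    (H : ∀ (ω : sphere (0 : E) 1) (ξ η : E), charFun m ξ * charFun m η =
      charFun m (collide ω (ξ, η)).1 * charFun m (collide ω (ξ, η)).2)
    {a b : E} (hab : ⟪a, b⟫_ℝ = 0) : charFun m (a + b) = charFun m a * charFun m b := by
  by_cases hb : b = 0
  · subst hb
    simp [charFun_zero]
  have hn : ‖b‖ ≠ 0 := norm_ne_zero_iff.mpr hb
  obtain ⟨ω, hω⟩ : ∃ ω : sphere (0 : E) 1, (ω : E) = ‖b‖⁻¹ • b :=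
    ⟨⟨‖b‖⁻¹ • b, by
      rw [mem_sphere_zero_iff_norm, norm_smul, norm_inv, norm_norm, inv_mul_cancel₀ hn]⟩, rfl⟩
  have key := H ω (a + b) 0
  rw [collide_add_zero_eq hab hb ω hω] at key
  simpa [charFun_zero] using key

omit [FiniteDimensional ℝ E] [BorelSpace E] in
/-- The modulus `‖φ‖` of a collision-invariant characteristic function is radial:
`‖p‖ = ‖q‖ → ‖φ p‖ = ‖φ q‖` (write `p = a + b`, `q = a - b` with `a ⊥ b`). -/
theorem norm_charFun_radial
    (H : ∀ (ω : sphere (0 : E) 1) (ξ η : E), charFun m ξ * charFun m η =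
      charFun m (collide ω (ξ, η)).1 * charFun m (collide ω (ξ, η)).2)
    {p q : E} (hpq : ‖p‖ = ‖q‖) : ‖charFun m p‖ = ‖charFun m q‖ := by
  -- `p = a + b`, `q = a - b` with `a ⊥ b`
  set a : E := (1 / 2 : ℝ) • (p + q) with ha
  set b : E := (1 / 2 : ℝ) • (p - q) with hb
  have hab : ⟪a, b⟫_ℝ = 0 := by
    rw [ha, hb, real_inner_smul_left, real_inner_smul_right, inner_add_left, inner_sub_right,
      inner_sub_right, real_inner_self_eq_norm_sq, real_inner_self_eq_norm_sq, hpq,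
      real_inner_comm p q]
    ring
  have hab' : ⟪a, -b⟫_ℝ = 0 := by rw [inner_neg_right, hab, neg_zero]
  have hp : p = a + b := by
    rw [ha, hb, ← smul_add]
    have : p + q + (p - q) = (2 : ℝ) • p := by rw [two_smul]; abel
    rw [this, smul_smul]; norm_num
  have hq : q = a + -b := by
    rw [ha, hb, ← smul_neg, ← smul_add]
    have : p + q + -(p - q) = (2 : ℝ) • q := by rw [two_smul]; abel
    rw [this, smul_smul]; norm_num
  rw [hp, hq, charFun_add_of_inner_eq_zero m H hab, charFun_add_of_inner_eq_zero m H hab',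
    norm_mul, norm_mul, charFun_neg, Complex.norm_conj]

/-- The modulus of a collision-invariant characteristic function never vanishes. -/
theorem norm_charFun_pos (hE : 2 ≤ Module.finrank ℝ E)
    (H : ∀ (ω : sphere (0 : E) 1) (ξ η : E), charFun m ξ * charFun m η =
      charFun m (collide ω (ξ, η)).1 * charFun m (collide ω (ξ, η)).2)
    (ξ : E) : 0 < ‖charFun m ξ‖ := by
  by_contra hcon
  have h0 : ‖charFun m ξ‖ = 0 := le_antisymm (not_lt.1 hcon) (norm_nonneg _)
  obtain ⟨e₁, e₂, he₁, he₂, he₁₂⟩ := exists_orthonormal_pair hE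
  set r : ℝ := ‖ξ‖ with hr
  -- `g t = ‖φ (t • e₁)‖`
  set g : ℝ → ℝ := fun t => ‖charFun m (t • e₁)‖ with hg
  have hgr : g r = 0 := by
    simp only [hg]
    rw [← h0]
    exact norm_charFun_radial m H (by rw [norm_smul, he₁, mul_one, Real.norm_eq_abs, hr,
      abs_norm])
  have hrec : ∀ t, 0 ≤ t → g (Real.sqrt 2 * t) = g t ^ 2 := by
    intro t ht
    simp only [hg]
    have horth : ⟪t • e₁, t • e₂⟫_ℝ = 0 := by
      rw [real_inner_smul_left, real_inner_smul_right, he₁₂, mul_zero, mul_zero]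
    have hnorm : ‖(Real.sqrt 2 * t) • e₁‖ = ‖t • e₁ + t • e₂‖ := by
      have h2 : ‖t • e₁ + t • e₂‖ ^ 2 = (Real.sqrt 2 * t) ^ 2 := by
        rw [norm_add_sq_real, horth, norm_smul, norm_smul, he₁, he₂, mul_pow,
          Real.norm_eq_abs, sq_abs, mul_pow, Real.sq_sqrt (by norm_num : (0:ℝ) ≤ 2)]
        ring
      rw [norm_smul, he₁, mul_one, Real.norm_eq_abs, abs_of_nonneg (by positivity)]
      rw [← abs_of_nonneg (by positivity : 0 ≤ Real.sqrt 2 * t), ← abs_norm (t • e₁ + t • e₂)]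
      exact (sq_eq_sq_iff_abs_eq_abs _ _).1 h2.symm
    rw [norm_charFun_radial m H hnorm, charFun_add_of_inner_eq_zero m H horth, norm_mul,
      norm_charFun_radial m H (p := t • e₂) (q := t • e₁) (by rw [norm_smul, norm_smul, he₁, he₂]),
      sq]
  -- the sequence `r / √2^n`
  set u : ℕ → ℝ := fun n => r * (Real.sqrt 2)⁻¹ ^ n with hu
  have hu0 : ∀ n, 0 ≤ u n := fun n => by positivity
  have hgu : ∀ n, g (u n) = 0 := by
    intro n
    induction n with
    | zero => simpa [hu] using hgr
    | succ n ih =>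
      have hstep : u n = Real.sqrt 2 * u (n + 1) := by
        simp only [hu, pow_succ]
        field_simp
      rw [hstep, hrec _ (hu0 _)] at ih
      exact pow_eq_zero_iff two_ne_zero |>.1 ih
  have hlim : Tendsto u atTop (𝓝 0) := by
    have h := tendsto_pow_atTop_nhds_zero_of_lt_one (r := (Real.sqrt 2)⁻¹) (by positivity)
      (inv_lt_one_of_one_lt₀ (by
        rw [show (1:ℝ) = Real.sqrt 1 from Real.sqrt_one.symm]
        exact Real.sqrt_lt_sqrt zero_le_one one_lt_two))
    simpa [hu] using h.const_mul r
  have hgcont : Continuous g := by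
    simp only [hg]
    exact (continuous_charFun.comp (continuous_id.smul continuous_const)).norm
  have h1 : Tendsto (g ∘ u) atTop (𝓝 (g 0)) := (hgcont.tendsto 0).comp hlim
  have h2 : Tendsto (g ∘ u) atTop (𝓝 0) := by
    have : g ∘ u = fun _ => 0 := funext fun n => hgu n
    rw [this]
    exact tendsto_const_nhds
  have h3 : g 0 = 0 := tendsto_nhds_unique h1 h2
  simp [hg, charFun_zero] at h3

/-- **Modulus.** The modulus of a collision-invariant characteristic function is Gaussian:
`‖φ ξ‖ = exp (-θ ‖ξ‖²)` for some `θ ≥ 0` (`log ‖φ‖²` is a continuous, even collision invariant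
vanishing at `0`, hence `c‖ξ‖²` by `IsCollisionInvariant.exists_eq_quadratic_holds`). -/
theorem exists_norm_charFun_eq_exp (hE : 2 ≤ Module.finrank ℝ E)
    (H : ∀ (ω : sphere (0 : E) 1) (ξ η : E), charFun m ξ * charFun m η =
      charFun m (collide ω (ξ, η)).1 * charFun m (collide ω (ξ, η)).2) :
    ∃ θ : ℝ, 0 ≤ θ ∧ ∀ ξ, ‖charFun m ξ‖ = Real.exp (-θ * ‖ξ‖ ^ 2) := by
  set L : E → ℝ := fun ξ => Real.log (‖charFun m ξ‖ ^ 2) with hL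
  have hpos := norm_charFun_pos m hE H
  have hinv : IsCollisionInvariant L := by
    intro ω p
    simp only [hL]
    rw [← Real.log_mul (pow_pos (hpos _) 2).ne' (pow_pos (hpos _) 2).ne',
      ← Real.log_mul (pow_pos (hpos _) 2).ne' (pow_pos (hpos _) 2).ne', ← mul_pow, ← mul_pow,
      ← norm_mul, ← norm_mul, ← H ω p.1 p.2]
  have hcont : Continuous L := by
    simp only [hL]
    exact (continuous_charFun.norm.pow 2).log fun ξ => (pow_pos (hpos ξ) 2).ne'
  obtain ⟨a, c, b, habc⟩ := IsCollisionInvariant.exists_eq_quadratic_holds hE hinv hcont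
  have hL0 : L 0 = 0 := by simp [hL, charFun_zero]
  have ha : a = 0 := by
    have := habc 0
    rw [hL0, inner_zero_right, norm_zero] at this
    linarith
  have heven : ∀ ξ, L (-ξ) = L ξ := by
    intro ξ
    simp only [hL, charFun_neg, Complex.norm_conj]
  have hb : ∀ ξ, ⟪b, ξ⟫_ℝ = 0 := by
    intro ξ
    have h1 := habc ξ
    have h2 := habc (-ξ)
    rw [heven, inner_neg_right, norm_neg] at h2
    linarith
  have hLc : ∀ ξ, L ξ = c * ‖ξ‖ ^ 2 := by
    intro ξ
    rw [habc ξ, ha, hb, zero_add, zero_add]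
  obtain ⟨e₁, -, he₁, -, -⟩ := exists_orthonormal_pair hE
  have hc : c ≤ 0 := by
    have h1 : L e₁ ≤ 0 := by
      simp only [hL]
      refine Real.log_nonpos (by positivity) ?_
      exact pow_le_one₀ (norm_nonneg _) (norm_charFun_le_one _)
    rw [hLc, he₁, one_pow, mul_one] at h1
    exact h1
  refine ⟨-c / 2, by linarith, fun ξ => ?_⟩
  have h1 : Real.log (‖charFun m ξ‖ ^ 2) = c * ‖ξ‖ ^ 2 := hLc ξ
  have h2 : ‖charFun m ξ‖ ^ 2 = Real.exp (c * ‖ξ‖ ^ 2) := by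
    rw [← h1, Real.exp_log (pow_pos (hpos ξ) 2)]
  have h3 : Real.exp (c * ‖ξ‖ ^ 2) = Real.exp (-(-c / 2) * ‖ξ‖ ^ 2) ^ 2 := by
    rw [← Real.exp_nat_mul]
    congr 1
    push_cast
    ring
  rw [h3] at h2
  exact (pow_left_inj₀ (norm_nonneg _) (Real.exp_pos _).le two_ne_zero).1 h2

end Modulus

end Summit.AtomisticToContinuum.HydrodynamicLimit.Theorems.ParityRigidity
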